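import Mathlib.Combinatorics.SimpleGraph.Clique
import Mathlib.Combinatorics.SimpleGraph.Coloring.Vertex
import Mathlib.LinearAlgebra.Matrix.PosDef
import Mathlib.LinearAlgebra.Matrix.Trace
import Mathlib.Algebra.Order.Star.Real
import Mathlib.Algebra.Order.Archimedean.Real.Basic
import HarnessLib

/-!
# The Lovász number `ϑ` and the sandwich theorem `ω(G) ≤ ϑ(Ḡ) ≤ χ(G)`

Lovász's theta number of a finite graph `H` in its semidefinite (maximisation) form
(Lovász 1979; Brouwer–Haemers 2012, §3.7, PDF p. 59): `ϑ(H)` is the largest value of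
`Tr(BJ) = Σ_{u,v} B_{uv}` over real positive semidefinite matrices `B` with `Tr B = 1` and
`B_{uv} = 0` whenever `u` and `v` are adjacent in `H`. We define it as a real supremum
(`lovaszTheta`) and PROVE the two halves of the **sandwich theorem** in the form used by
Tardos (1988) and Jukna (2012, Lemma 9.27: "`φ'(G) := ϑ(Ḡ)` … is a monotone clique-like
function", i.e. `ω(G) ≤ ϑ(Ḡ) ≤ χ(G)`):

* `le_lovaszTheta_compl_of_isNClique` — an `s`-clique of `G` gives `s ≤ ϑ(Gᶜ)` (the matrix
  `s⁻¹ 𝟙_S 𝟙_Sᵀ` is feasible);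
* `lovaszTheta_compl_le_of_coloring` — a proper colouring of `G` with `c` colours gives
  `ϑ(Gᶜ) ≤ c` (for feasible `B` and colour classes `V₁, …, V_c`:
  `𝟙ᵀB𝟙 = Σ_{a,b} 𝟙_aᵀ B 𝟙_b ≤ Σ_{a,b} (𝟙_aᵀB𝟙_a + 𝟙_bᵀB𝟙_b)/2 = c · Tr B = c`, since
  `2 xᵀBy ≤ xᵀBx + yᵀBy` for positive semidefinite `B` and `B` vanishes off the diagonal inside a
  colour class);
* `lovaszTheta_anti` — `ϑ` is antitone in the graph (more edges, more constraints), so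
  `G ↦ ϑ(Gᶜ)` is monotone (`lovaszTheta_compl_mono`), the monotonicity Tardos needs;
* `entrySum_le_card` — the crude bound `ϑ(H) ≤ |V|` making the supremum well defined.

Not here: the other characterisations of `ϑ` (Lovász's original definition by orthonormal
representations, the eigenvalue minimum; Lovász 1979) and their equality with this one, the Shannon-capacity bound,
and any algorithm (Grötschel–Lovász–Schrijver 1981) — `ϑ` is only DEFINED and sandwiched.
Mathlib has positive semidefinite matrices (`Matrix.PosSemidef`), cliques (`SimpleGraph.IsNClique`)
and colourings (`SimpleGraph.Coloring`) but no theta number (searched `lovasz`, `theta`,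
`Shannon capacity`).

## References

* L. Lovász, *On the Shannon capacity of a graph*, IEEE Trans. Inform. Theory 25 (1979) 1–7
  (the maximisation form `max Tr(BJ)`, and the bounds `α(G) ≤ ϑ(G) ≤ χ(Ḡ)`) [Lovasz1979]
  (text not held at the time of writing; theorem numbers deliberately not quoted).
* A. E. Brouwer, W. H. Haemers, *Spectra of Graphs* (2012), §3.7 (PDF pp. 58–59: "`N` is
  positive semidefinite, `tr N = 1`, and `N_{uv} = 0` …") [BrouwerHaemers2012].
* S. Jukna, *Boolean Function Complexity* (2012), Lemma 9.27 (PDF p. 286) [Jukna2012].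
* É. Tardos, Combinatorica 8 (1988) 141–142, p. 142 [Tardos1988].
-/

namespace Literature.Combinatorics.SimpleGraph

open Matrix Finset

variable {V : Type*} [Fintype V]

/-! ### Feasible matrices and the theta number -/

/-- The feasible matrices of Lovász's semidefinite programme for `ϑ(H)`: real positive
semidefinite `B` with trace `1` vanishing on the edges of `H` (Lovász 1979; Brouwer–Haemers
2012, §3.7, PDF p. 59: "`N` is positive semidefinite, `tr N = 1`, and `N_{uv} = 0` if `u` …").
[cite: Lovasz1979] [cite: BrouwerHaemers2012, §3.7 (PDF p. 59)] -/
structure IsThetaFeasible (H : SimpleGraph V) (B : Matrix V V ℝ) : Prop where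
  /-- `B` is positive semidefinite -/
  posSemidef : B.PosSemidef
  /-- `Tr B = 1` -/
  trace_eq_one : B.trace = 1
  /-- `B_{uv} = 0` on edges of `H` -/
  apply_eq_zero : ∀ ⦃u v : V⦄, H.Adj u v → B u v = 0

/-- The objective `Tr(BJ) = 𝟙ᵀ B 𝟙 = Σ_{u,v} B_{uv}` of Lovász's programme (Lovász 1979;
Brouwer–Haemers 2012, §3.7). [cite: Lovasz1979] [cite: BrouwerHaemers2012, §3.7 (PDF p. 59)] -/
def entrySum (B : Matrix V V ℝ) : ℝ := ∑ u, ∑ v, B u v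

/-- **Lovász's theta number** `ϑ(H) = sup { Σ_{u,v} B_{uv} : B ⪰ 0, Tr B = 1, B_{uv} = 0 for
`uv ∈ E(H)` }` (Lovász 1979, where it is shown to equal the orthonormal-representation
definition; Brouwer–Haemers 2012, §3.7, PDF p. 59). A real supremum; the feasible set is nonempty as soon
as `V` is (`isThetaFeasible_smul_one`) and the objective is bounded by `|V|`
(`entrySum_le_card`), so for nonempty `V` this is a genuine supremum (indeed a maximum, by
compactness, which we do not prove); for empty `V` it is the junk value `sSup ∅ = 0`.
[cite: Lovasz1979] [cite: BrouwerHaemers2012, §3.7 (PDF p. 59)] -/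
noncomputable def lovaszTheta (H : SimpleGraph V) : ℝ :=
  sSup (entrySum '' {B | IsThetaFeasible H B})

/-! ### Positive semidefinite bookkeeping -/

/-- For a real positive semidefinite `B`: `2 xᵀBy ≤ xᵀBx + yᵀBy` (expand
`(x - y)ᵀ B (x - y) ≥ 0`, using symmetry). [folklore] -/
theorem two_mul_dotProduct_mulVec_le {B : Matrix V V ℝ} (hB : B.PosSemidef) (x y : V → ℝ) :
    2 * (x ⬝ᵥ B *ᵥ y) ≤ x ⬝ᵥ B *ᵥ x + y ⬝ᵥ B *ᵥ y := by
  have hsymm : Bᵀ = B := by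
    have h := hB.1
    rwa [Matrix.IsHermitian, conjTranspose_eq_transpose_of_trivial] at h
  have hyx : y ⬝ᵥ B *ᵥ x = x ⬝ᵥ B *ᵥ y := by
    rw [dotProduct_mulVec, ← mulVec_transpose, hsymm, dotProduct_comm]
  have h0 : 0 ≤ (x - y) ⬝ᵥ B *ᵥ (x - y) := by
    have := hB.dotProduct_mulVec_nonneg (x - y)
    rwa [star_trivial] at this
  rw [mulVec_sub, sub_dotProduct, dotProduct_sub, dotProduct_sub, hyx] at h0
  linarith

/-- Off-diagonal entries of a positive semidefinite real matrix: `2 B_{uv} ≤ B_{uu} + B_{vv}`.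
[folklore] -/
theorem two_mul_apply_le [DecidableEq V] {B : Matrix V V ℝ} (hB : B.PosSemidef) (u v : V) :
    2 * B u v ≤ B u u + B v v := by
  have h := two_mul_dotProduct_mulVec_le hB (Pi.single u 1) (Pi.single v 1)
  simpa [dotProduct_mulVec, single_one_vecMul, dotProduct_single] using h

/-- The indicator vector of a finite set of vertices. [folklore] -/
def indVec [DecidableEq V] (S : Finset V) : V → ℝ := fun u => if u ∈ S then 1 else 0

/-- `𝟙_Sᵀ B 𝟙_T = Σ_{u ∈ S} Σ_{v ∈ T} B_{uv}`. [folklore] -/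
theorem indVec_dotProduct_mulVec_indVec [DecidableEq V] (B : Matrix V V ℝ) (S T : Finset V) :
    indVec S ⬝ᵥ B *ᵥ indVec T = ∑ u ∈ S, ∑ v ∈ T, B u v := by
  simp only [dotProduct, mulVec, indVec, mul_boole, boole_mul, Finset.sum_ite_mem,
    Finset.univ_inter]

/-- The objective is the quadratic form at the all-ones vector: `Σ_{u,v} B_{uv} = 𝟙ᵀ B 𝟙`.
[folklore] -/
theorem entrySum_eq [DecidableEq V] (B : Matrix V V ℝ) :
    entrySum B = indVec (univ : Finset V) ⬝ᵥ B *ᵥ indVec univ := by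
  rw [indVec_dotProduct_mulVec_indVec, entrySum]

/-- The objective is bounded by the order of the graph: `Σ_{u,v} B_{uv} ≤ |V| · Tr B = |V|`
for feasible `B` (so `ϑ(H) ≤ |V|`). [folklore] -/
theorem entrySum_le_card [DecidableEq V] {H : SimpleGraph V} {B : Matrix V V ℝ}
    (hB : IsThetaFeasible H B) : entrySum B ≤ Fintype.card V := by
  have h1 : ∀ u v, B u v ≤ (B u u + B v v) / 2 := fun u v => by
    linarith [two_mul_apply_le hB.posSemidef u v]
  have htr : ∑ u, B u u = 1 := by
    have := hB.trace_eq_one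
    rwa [Matrix.trace] at this
  have h2 : ∑ u, ∑ v, (B u u + B v v) / 2 = (Fintype.card V : ℝ) * ∑ u, B u u := by
    simp only [add_div, sum_add_distrib, sum_const, card_univ, nsmul_eq_mul]
    rw [mul_sum, mul_sum, ← sum_add_distrib]
    exact sum_congr rfl fun u _ => by ring
  calc entrySum B = ∑ u, ∑ v, B u v := rfl
    _ ≤ ∑ u, ∑ v, (B u u + B v v) / 2 := sum_le_sum fun u _ => sum_le_sum fun v _ => h1 u v
    _ = Fintype.card V := by rw [h2, htr, mul_one]

/-- The feasible values are bounded above (by `|V|`). [folklore] -/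
theorem bddAbove_thetaValues (H : SimpleGraph V) :
    BddAbove (entrySum '' {B | IsThetaFeasible H B}) := by
  classical
  refine ⟨Fintype.card V, ?_⟩
  rintro _ ⟨B, hB, rfl⟩
  exact entrySum_le_card hB

/-- `|V|⁻¹ · I` is feasible for every graph on a nonempty vertex set. [folklore] -/
theorem isThetaFeasible_smul_one [DecidableEq V] [Nonempty V] (H : SimpleGraph V) :
    IsThetaFeasible H ((Fintype.card V : ℝ)⁻¹ • (1 : Matrix V V ℝ)) where
  posSemidef := PosSemidef.one.smul (by positivity)
  trace_eq_one := by
    have hn : (Fintype.card V : ℝ) ≠ 0 := by exact_mod_cast Fintype.card_ne_zero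
    rw [trace_smul, trace_one, smul_eq_mul, inv_mul_cancel₀ hn]
  apply_eq_zero u v huv := by
    simp [huv.ne]

/-- `0 ≤ ϑ(H)`: every feasible value `𝟙ᵀB𝟙` is nonnegative (and `sSup ∅ = 0`). [folklore] -/
theorem lovaszTheta_nonneg [DecidableEq V] (H : SimpleGraph V) : 0 ≤ lovaszTheta H := by
  refine Real.sSup_nonneg ?_
  rintro _ ⟨B, hB, rfl⟩
  rw [entrySum_eq]
  have := hB.posSemidef.dotProduct_mulVec_nonneg (indVec univ)
  rwa [star_trivial] at this

/-- `ϑ(H) ≤ |V|` (Lovász 1979: `ϑ(G) ≤ χ(Ḡ) ≤ |V|`; here directly from `entrySum_le_card`).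
[folklore] -/
theorem lovaszTheta_le_card [DecidableEq V] (H : SimpleGraph V) :
    lovaszTheta H ≤ Fintype.card V := by
  refine Real.sSup_le ?_ (Nat.cast_nonneg _)
  rintro _ ⟨B, hB, rfl⟩
  exact entrySum_le_card hB

/-! ### Antitonicity: more edges, smaller `ϑ` -/

/-- Feasibility is inherited by subgraphs: fewer edges, fewer constraints. [folklore] -/
theorem IsThetaFeasible.anti {H H' : SimpleGraph V} (hHH' : H' ≤ H) {B : Matrix V V ℝ}
    (hB : IsThetaFeasible H B) : IsThetaFeasible H' B :=
  ⟨hB.posSemidef, hB.trace_eq_one, fun _ _ huv => hB.apply_eq_zero (hHH' huv)⟩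

/-- **`ϑ` is antitone**: `H' ≤ H → ϑ(H) ≤ ϑ(H')` (immediate from the maximisation form:
fewer edges, fewer constraints). [folklore] -/
theorem lovaszTheta_anti [DecidableEq V] {H H' : SimpleGraph V} (hHH' : H' ≤ H) :
    lovaszTheta H ≤ lovaszTheta H' := by
  by_cases hne : ({B | IsThetaFeasible H B} : Set (Matrix V V ℝ)).Nonempty
  · exact csSup_le_csSup (bddAbove_thetaValues H') (hne.image _)
      (Set.image_mono fun B hB => IsThetaFeasible.anti hHH' hB)
  · rw [Set.not_nonempty_iff_eq_empty] at hne
    rw [lovaszTheta, hne, Set.image_empty, Real.sSup_empty]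
    exact lovaszTheta_nonneg H'

/-- **Monotonicity of `G ↦ ϑ(Gᶜ)`** (Jukna 2012, Lemma 9.27: "`φ'(G) := ϑ(Ḡ)` … is a
monotone clique-like function"; Tardos 1988, p. 142): adding edges to `G` removes edges from
`Gᶜ`. [cite: Jukna2012, Lemma 9.27 (PDF p. 286)] -/
theorem lovaszTheta_compl_mono [DecidableEq V] {G G' : SimpleGraph V} (hGG' : G ≤ G') :
    lovaszTheta Gᶜ ≤ lovaszTheta G'ᶜ :=
  lovaszTheta_anti (compl_le_compl hGG')

/-! ### The clique bound `ω(G) ≤ ϑ(Gᶜ)` -/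

/-- The normalised clique matrix `s⁻¹ 𝟙_S 𝟙_Sᵀ` of an `s`-clique `S` of `G` is feasible for
`Gᶜ` (its support consists of loops and edges of `G`) and has objective value `s`
(Lovász 1979, the bound `α(G) ≤ ϑ(G)`, applied to `Gᶜ`). [cite: Lovasz1979] -/
theorem isThetaFeasible_cliqueMatrix [DecidableEq V] {G : SimpleGraph V} {s : ℕ} {S : Finset V}
    (hS : G.IsNClique s S) (hs : s ≠ 0) :
    IsThetaFeasible Gᶜ ((s : ℝ)⁻¹ • vecMulVec (indVec S) (indVec S)) ∧
      entrySum ((s : ℝ)⁻¹ • vecMulVec (indVec S) (indVec S)) = s := by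
  have hs' : (s : ℝ) ≠ 0 := by exact_mod_cast hs
  have hcard : #S = s := hS.card_eq
  refine ⟨⟨?_, ?_, ?_⟩, ?_⟩
  · have h := posSemidef_vecMulVec_self_star (R := ℝ) (indVec S)
    rw [star_trivial] at h
    exact h.smul (by positivity)
  · rw [trace_smul, smul_eq_mul]
    have htr : (vecMulVec (indVec S) (indVec S)).trace = s := by
      simp only [Matrix.trace, Matrix.diag, vecMulVec_apply, indVec, mul_ite, mul_one, mul_zero]
      rw [Finset.sum_ite_mem, univ_inter]
      simp [hcard]
    rw [htr, inv_mul_cancel₀ hs']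
  · intro u v huv
    rw [SimpleGraph.compl_adj] at huv
    simp only [Matrix.smul_apply, vecMulVec_apply, indVec, smul_eq_mul, mul_ite, mul_one,
      mul_zero]
    by_cases hu : u ∈ S
    · by_cases hv : v ∈ S
      · exact absurd (hS.isClique hu hv huv.1) huv.2
      · simp [hv]
    · simp [hu]
  · have h1 : entrySum ((s : ℝ)⁻¹ • vecMulVec (indVec S) (indVec S)) =
        (s : ℝ)⁻¹ * ∑ u, ∑ v, indVec S u * indVec S v := by
      simp only [entrySum, Matrix.smul_apply, vecMulVec_apply, smul_eq_mul, mul_sum]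
    have h2 : ∑ u, ∑ v, indVec S u * indVec S v = (s : ℝ) * s := by
      have h3 : ∑ v, indVec S v = s := by
        simp only [indVec]
        rw [Finset.sum_boole, Finset.filter_mem_eq_inter, univ_inter, hcard]
      simp_rw [← mul_sum, h3, ← sum_mul, h3]
    rw [h1, h2, ← mul_assoc, inv_mul_cancel₀ hs', one_mul]

/-- **Clique half of the sandwich theorem** (Lovász 1979: `α(G) ≤ ϑ(G)`, here for the
complement, `ω(G) ≤ ϑ(Gᶜ)`; Jukna 2012, Lemma 9.27; Tardos 1988, p. 142 (∗)): if `G` has an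
`s`-clique then `s ≤ ϑ(Gᶜ)`. [cite: Lovasz1979] [cite: Jukna2012, Lemma 9.27 (PDF p. 286)] -/
theorem le_lovaszTheta_compl_of_isNClique [DecidableEq V] {G : SimpleGraph V} {s : ℕ}
    {S : Finset V} (hS : G.IsNClique s S) : (s : ℝ) ≤ lovaszTheta Gᶜ := by
  rcases eq_or_ne s 0 with rfl | hs
  · rw [Nat.cast_zero]
    exact lovaszTheta_nonneg _
  · obtain ⟨hfeas, hval⟩ := isThetaFeasible_cliqueMatrix hS hs
    rw [← hval]
    exact le_csSup (bddAbove_thetaValues _) ⟨_, hfeas, rfl⟩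

/-! ### The colouring bound `ϑ(Gᶜ) ≤ χ(G)` -/

/-- For a feasible `B` (for `Gᶜ`) and a proper colouring of `G` with colour classes `V_a`:
within a class `B` vanishes off the diagonal, so `𝟙_aᵀ B 𝟙_a = Σ_{u ∈ V_a} B_{uu}`. [folklore] -/
theorem indVec_colorClass_self [DecidableEq V] {G : SimpleGraph V} {B : Matrix V V ℝ}
    (hB : IsThetaFeasible Gᶜ B) {c : ℕ} (C : G.Coloring (Fin c)) (a : Fin c) :
    indVec (univ.filter fun u => C u = a) ⬝ᵥ B *ᵥ indVec (univ.filter fun u => C u = a) =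
      ∑ u ∈ univ.filter (fun u => C u = a), B u u := by
  rw [indVec_dotProduct_mulVec_indVec]
  refine sum_congr rfl fun u hu => ?_
  rw [sum_eq_single_of_mem u hu]
  intro v hv hvu
  have hcu := (mem_filter.1 hu).2
  have hcv := (mem_filter.1 hv).2
  refine hB.apply_eq_zero ((SimpleGraph.compl_adj _ _ _).2 ⟨fun h => hvu h.symm, fun hadj => ?_⟩)
  exact C.valid hadj (hcu.trans hcv.symm)

/-- **Colouring half of the sandwich theorem** (Lovász 1979: `ϑ(G) ≤ χ(Ḡ)`, here for the
complement, `ϑ(Gᶜ) ≤ χ(G)`; Jukna 2012, Lemma 9.27; Tardos 1988, p. 142 (∗)): if `G` has a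
proper colouring with `c` colours then `ϑ(Gᶜ) ≤ c`. Proof: for feasible `B` and colour classes
`V_1, …, V_c`, `𝟙ᵀB𝟙 = Σ_{a,b} 𝟙_aᵀB𝟙_b ≤ Σ_{a,b} (𝟙_aᵀB𝟙_a + 𝟙_bᵀB𝟙_b)/2 = c Σ_a 𝟙_aᵀB𝟙_a
= c · Tr B = c`. [cite: Lovasz1979] [cite: Jukna2012, Lemma 9.27 (PDF p. 286)] -/
theorem lovaszTheta_compl_le_of_coloring [DecidableEq V] {G : SimpleGraph V} {c : ℕ}
    (C : G.Coloring (Fin c)) : lovaszTheta Gᶜ ≤ c := by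
  refine Real.sSup_le ?_ (Nat.cast_nonneg c)
  rintro _ ⟨B, hB, rfl⟩
  -- colour classes and their indicator forms
  set cls : Fin c → Finset V := fun a => univ.filter fun u => C u = a with hcls
  set F : Fin c → Fin c → ℝ := fun a b => indVec (cls a) ⬝ᵥ B *ᵥ indVec (cls b) with hF
  -- split the objective along the classes
  have hsplit : entrySum B = ∑ a, ∑ b, F a b := by
    have h1 : ∀ f : V → ℝ, ∑ u, f u = ∑ a, ∑ u ∈ cls a, f u := fun f =>
      (sum_fiberwise (univ : Finset V) C f).symm
    calc entrySum B = ∑ u, ∑ v, B u v := rfl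
      _ = ∑ a, ∑ u ∈ cls a, ∑ b, ∑ v ∈ cls b, B u v := by
          rw [h1]
          refine sum_congr rfl fun a _ => sum_congr rfl fun u _ => h1 _
      _ = ∑ a, ∑ b, ∑ u ∈ cls a, ∑ v ∈ cls b, B u v := by
          refine sum_congr rfl fun a _ => ?_
          rw [sum_comm]
      _ = ∑ a, ∑ b, F a b :=
          sum_congr rfl fun a _ => sum_congr rfl fun b _ =>
            (indVec_dotProduct_mulVec_indVec B (cls a) (cls b)).symm
  -- diagonal forms sum to the trace
  have hdiag : ∑ a, F a a = 1 := by
    have h1 : ∀ a, F a a = ∑ u ∈ cls a, B u u := fun a => indVec_colorClass_self hB C a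
    simp_rw [h1]
    rw [sum_fiberwise (univ : Finset V) C fun u => B u u]
    have := hB.trace_eq_one
    rwa [Matrix.trace] at this
  -- the arithmetic–geometric step
  have hab : ∀ a b, F a b ≤ (F a a + F b b) / 2 := fun a b => by
    have := two_mul_dotProduct_mulVec_le hB.posSemidef (indVec (cls a)) (indVec (cls b))
    simp only [hF] at this ⊢
    linarith
  have hsum : ∑ a, ∑ b, (F a a + F b b) / 2 = (c : ℝ) * ∑ a, F a a := by
    simp only [add_div, sum_add_distrib, sum_const, card_univ, Fintype.card_fin, nsmul_eq_mul]
    rw [mul_sum, mul_sum, ← sum_add_distrib]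
    exact sum_congr rfl fun a _ => by ring
  calc entrySum B = ∑ a, ∑ b, F a b := hsplit
    _ ≤ ∑ a, ∑ b, (F a a + F b b) / 2 := sum_le_sum fun a _ => sum_le_sum fun b _ => hab a b
    _ = c := by rw [hsum, hdiag, mul_one]

/-- **The sandwich theorem, clique-number / chromatic-number form** (Lovász 1979;
Jukna 2012, Lemma 9.27: `ω(G) ≤ ϑ(Ḡ) ≤ χ(G)`): for a graph with an `s`-clique and a proper
`c`-colouring, `s ≤ ϑ(Gᶜ) ≤ c`. [cite: Jukna2012, Lemma 9.27 (PDF p. 286)] -/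
theorem lovaszTheta_compl_sandwich [DecidableEq V] {G : SimpleGraph V} {s c : ℕ} {S : Finset V}
    (hS : G.IsNClique s S) (C : G.Coloring (Fin c)) :
    (s : ℝ) ≤ lovaszTheta Gᶜ ∧ lovaszTheta Gᶜ ≤ c :=
  ⟨le_lovaszTheta_compl_of_isNClique hS, lovaszTheta_compl_le_of_coloring C⟩

end Literature.Combinatorics.SimpleGraph
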